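import Summits.HodgeConjecture.HodgeConjecture.Theorems.NikulinTwinTransportTwinTwistorTransportCmTwinAnchor
import Summits.HodgeConjecture.HodgeConjecture.Theorems.NikulinTwinTransportHodgeSimilitudeAlgebraicCmNormDense
import Summits.HodgeConjecture.HodgeConjecture.Theorems.NikulinTwinTransportTwinTwistorTransportMukaiLiftDefs
import Literature.AlgebraicGeometry.Surfaces.PolarisedK3TwinKuranishiFamily
import Literature.NumberTheory.Transcendental.DeRhamTheoremMultiplicative

/-!
# Crux `NikulinTwinTransport.TwinTwistorTransport` (stmt-HodgeConjecture-14393) —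
# line `mukai-lift-full-similitude`, stub `CmTwinAnchor`: the CM twin anchor (conditional form)

Stub 2 of the checked skeleton `Cruxes/TwinTwistorTransport/Lines/mukai_lift_full_similitude.lean`
(reshape r2 of `NikulinAnchor`; registered statement, verbatim, over the landed vocabulary of
`Theorems/NikulinTwinTransportTwinTwistorTransportMukaiLiftDefs.lean`).  Granted the surjectivity of
the period map (`K3PeriodSurjective`, route crux stmt-HodgeConjecture-15154, by name), Buskin's
theorem (`HodgeIsometryAlgebraic`, route item stmt-HodgeConjecture-13675, by name) and the three open
named facts of the line (`Huybrechts_K3_marking_exists`,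
`cupProduct_mem_algebraicClasses_tripleProduct_surfaces`, `Buskin2019_hodgeConjectureFor_square_of_CM`):
for EVERY rational lattice `2`-similitude `M` of `(Λ_ℂ, k3Form)` with rational two-sided inverse `N`
and every orientation family with Poincaré duality there is ONE marked projective `M`-twin pair
`(S₀, η₀, p₀, x₀)`, `(S₀', η₀', p₀', x₀')` (`M x₀' ∈ ℂ x₀`) on which the twin similitude
`η₀⁻¹ ∘ M ∘ η₀'` is induced by an algebraic class (`TwinAlg`).

## Proof (pure glue over landed theorems)

The sibling line's landed anchor theorem `OrdinaryPrimeAnchors.stub_cmTwinAnchor`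
(`Theorems/NikulinTwinTransportTwinTwistorTransportCmTwinAnchor.lean`) produces such a pair at every
projective CM-norm period `x₁` of multiplier `2`; the seed `CmNormAnchors.exists_cmNormPeriod 2`
(`Theorems/NikulinTwinTransportHodgeSimilitudeAlgebraicCmNormDense.lean`) is such a period; the fourth
conjunct `DeRham[]` of that theorem's `LineFacts[]` is the tree's theorem
`Literature.NumberTheory.Transcendental.exists_deRhamIsoFamily_holds`.  The two lines' vocabularies
agree definitionally (`IsMarkedK3 ≡ MarkedK3[]`, `PeriodPt ≡ PeriodPt[]`,
`IsTwoSimilitudePair ≡ Latt[]`, `TwinAlg ≡ Good[]`).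

References: [Buskin2019] N. Buskin, Every rational Hodge isometry between two K3 surfaces is
algebraic, J. reine angew. Math. 755 (2019), Thm. 1.1 and §6.2. [Huybrechts2019] D. Huybrechts,
Motives of isogenous K3 surfaces, Comment. Math. Helv. 94 (2019), Cor. 0.4 (ii).
-/

-- `Summit.HodgeConjecture.HodgeConjecture.…` (summit = problem) duplicates a namespace component by design (D-0017).
set_option linter.dupNamespace false
set_option autoImplicit false

noncomputable section

namespace Summit.HodgeConjecture.HodgeConjecture.Theorems.TwinTwistorTransport.MukaiLift

open CategoryTheory MonoidalCategory
open scoped Manifold BigOperators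
open Literature.AlgebraicGeometry.Motives Literature.AlgebraicGeometry.HodgeTheory
open Literature.AlgebraicGeometry.Surfaces Literature.AlgebraicGeometry.Hyperkaehler
open Literature.AlgebraicTopology.SingularHomology
open Literature.Geometry.Kaehler
open Summit.HodgeConjecture.HodgeConjecture.Theses.NikulinTwinTransport
open Summit.HodgeConjecture.HodgeConjecture.Theorems.NikulinTwinTransport

/-- **Stub 2 · `CmTwinAnchor`, THE CM TWIN ANCHOR, conditional form (registered statement, verbatim).**
Granted period surjectivity (`K3PeriodSurjective`), Buskin's theorem (`HodgeIsometryAlgebraic`) and the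
three open named facts of the line: for every rational lattice `2`-similitude pair `(M, N)` and every
orientation family with Poincaré duality there is a marked projective `M`-twin pair
`(S₀, η₀, p₀, x₀; S₀', η₀', p₀', x₀')` with `M x₀' ∈ ℂ x₀` whose twin similitude `η₀⁻¹ ∘ M ∘ η₀'` is
induced by an algebraic class.  Proof: the sibling line's landed `OrdinaryPrimeAnchors.stub_cmTwinAnchor`
at the CM-norm period `CmNormAnchors.exists_cmNormPeriod 2` (de Rham's theorem supplied by
`exists_deRhamIsoFamily_holds`). [cite: Buskin2019, Thm. 1.1 and §6.2] -/
theorem CmTwinAnchor : Theses.NikulinTwinTransport.K3PeriodSurjective → Theses.NikulinTwinTransport.HodgeIsometryAlgebraic → (Huybrechts_K3_marking_exists ∧ cupProduct_mem_algebraicClasses_tripleProduct_surfaces ∧ Buskin2019_hodgeConjectureFor_square_of_CM) → ∀ (M N : Module.End ℂ (K3Index → ℂ)), IsTwoSimilitudePair M N → ∀ (μ : OrientationFamily), μ.HasPoincareDuality → ∃ (S₀ S₀' : SchemeOver ℂ) (hS₀ : IsK3Surface S₀) (hS₀' : IsK3Surface S₀') (η₀ : complexBetti S₀ (2 * 1)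 ≃ₗ[ℂ] (K3Index → ℂ)) (p₀ : complexBetti S₀ (2 * 2)) (x₀ : K3Index → ℂ) (η₀' : complexBetti S₀' (2 * 1) ≃ₗ[ℂ] (K3Index → ℂ)) (p₀' : complexBetti S₀' (2 * 2)) (x₀' : K3Index → ℂ), IsMarkedK3 S₀ η₀ p₀ x₀ ∧ PeriodPt x₀ ∧ IsMarkedK3 S₀' η₀' p₀' x₀' ∧ PeriodPt x₀' ∧ (∃ t : ℂ, M x₀' = t • x₀) ∧ TwinAlg M μ S₀ S₀' hS₀ hS₀' η₀ η₀' := by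
  intro hP hB hF M N hMN μ hμ
  -- the seed: a projective CM-norm period `x₀` of multiplier `2`
  obtain ⟨x₀, hx₀, J, K, hJrat, hKrat, hJK, hKJ, hJ2, t, htim, hJx⟩ :=
    CmNormAnchors.exists_cmNormPeriod 2 two_pos
  have hJ2' : ∀ a b, k3Form (J a) (J b) = (2 : ℂ) * k3Form a b := fun a b => by
    rw [hJ2 a b, Nat.cast_ofNat]
  -- the lattice hypotheses, unfolded (`IsTwoSimilitudePair ≡ Latt[]`)
  obtain ⟨hMrat, hNrat, hMN1, hNM1, hM2⟩ := hMN
  -- the sibling line's landed anchor theorem at the seed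
  obtain ⟨S₀, S₀', hS₀, hS₀', η₀, p₀, η₀', p₀', x₀', hm₀, hm₀', hx₀', hper, -, hgood⟩ :=
    OrdinaryPrimeAnchors.stub_cmTwinAnchor M N ⟨hMrat, hNrat, hMN1, hNM1, hM2⟩ μ hμ hP hB
      ⟨hF.1, hF.2.1, hF.2.2,
        fun E _ _ _ => Literature.NumberTheory.Transcendental.exists_deRhamIsoFamily_holds E⟩
      x₀ hx₀ ⟨J, K, hJrat, hKrat, hJK, hKJ, hJ2', t, htim, hJx⟩
  exact ⟨S₀, S₀', hS₀, hS₀', η₀, p₀, x₀, η₀', p₀', x₀', hm₀, hx₀, hm₀', hx₀', hper, hgood⟩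

end Summit.HodgeConjecture.HodgeConjecture.Theorems.TwinTwistorTransport.MukaiLift

end
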